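import Literature.AnabelianGeometry.SemiGraphs.PSCUnrShadowTransfer
import Literature.AnabelianGeometry.SemiGraphs.PSCShadowGraphicPackages
import Literature.AnabelianGeometry.SemiGraphs.PSCMapAlongEquivTransfer
import HarnessLib

/-!
# Level packages from a group-theoretically verticial `β̄` between the pro-l shadows ([CombGC] Thm. 1.6 (iii), general `Σ`)

Mochizuki, *A combinatorial version of the Grothendieck conjecture*, Tohoku Math. J. **59** (2007)
[CombGC], proof of Thm. 1.6, author's ms p. 13 l.−8…−4 ("Since the … subgroups may be recovered as the
stabilizers of [vertices] of finite étale coverings … we may assume that `Σ = {l}`") and (iii) p. 14;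
row T16-L04c «(iii) general Σ» of the abc-iut sub-DAG `plan/L3/SUBDAG-CombGC-Thm16.md` (lineage
abc-iut-w4-d052).

At a `Π^unr_G`-covering `G_U = G.restrictBD U hU bd` (`U ⊴ Π_G` open, `U ⊇ Ker`) with `U' = β U`,
presentations `g`, `g'` of the maximal pro-`l` quotients, shadows `D`, `D'`, the isomorphism
`ρ : Q/Ker(Q ↠ Π^unr_D) ≅ Q'/Ker'` over `β` (`PSCUnrShadowTransfer`) and `L := ker(U ↠ Q ↠ Q/Ker)↑ ⊴ Π_G`,
`L'` likewise (`PSCUnrShadowKernel`):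

* `unrShadow_vertex_package`, `unrShadow_vertex_package'` — if `ρ` is GROUP-THEORETICALLY VERTICIAL
  (Def. 1.4 (iv), between the `Π^unr`'s of the shadows), then every level-`U` vertex class
  `U x Π_v` of `G` corresponds to a level-`U'` vertex class `U' y Π_w` of `H` under
  `β((U ∩ Π_v^x) · L) = (U' ∩ Π_w^y) · L'`, and conversely;
* `unrShadow_sep` — SEPARATION modulo `L`: `(U ∩ Π_{v₁}^{x₁}) · L` `U`-conjugate to
  `(U ∩ Π_{v₂}^{x₂}) · L` forces `U x₁ Π_{v₁} = U x₂ Π_{v₂}`, from Prop. 1.2 (i) (unramified verticial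
  case, `UnrVerticialOpenInterDeterminesVertex`) for the sturdy shadow `D` — abc-iut-w5-d174's GENERIC
  `sep_mod_ker_of_shadow` applied to the presentation `U ↠ Q ↠ Q/Ker`.

These are the inputs of the descent `PSCThm16iiiGeneralSigmaProofs`.  Proof-only, 0 defs; nothing
here takes a side on [IUTchIII] Cor. 3.12. [cite: MochizukiCombGC2007, Thm 1.6(iii) p.13]
-/

namespace Literature.AnabelianGeometry.SemiGraphs

open scoped Pointwise
open PSCCovering

universe u

namespace PSCDatum

/-! ### 1. Pulling an equality of shadows back to `Π_H` -/

section Pull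

variable {P' : Type u} [Group P'] [TopologicalSpace P'] [IsTopologicalGroup P']
variable {U' : Subgroup P'} [CompactSpace U'] (E' : PSCDatum U')
variable {Q' : Type u} [Group Q'] [TopologicalSpace Q'] [IsTopologicalGroup Q'] [T2Space Q']
variable {l : ℕ} (hSl' : ({l} : Set ℕ) ⊆ E'.Sigma) {g' : U' →* Q'} (hg' : IsMaxProSigmaQuotient {l} g')

include hg' in
omit [IsTopologicalGroup P'] in
/-- `g'⁻¹(g'(Y) · Ker(Q' ↠ Π^unr_{D'}))`, pushed into `Π_H`, is `Y↑ · L'` with `L' = ker(U' ↠ Q' ↠ Q'/Ker)↑`.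
[cite: MochizukiCombGC2007, Thm 1.6(iii) p.13] -/
theorem map_subtype_comap_map_sup_unrKer (Y : Subgroup U') :
    ((Y.map g' ⊔ (E'.mapAlong g' hg'.continuous {l} hSl' (Set.singleton_nonempty l) hg'.proSigma).unrKer).comap
        g').map U'.subtype =
      Y.map U'.subtype ⊔ (((QuotientGroup.mk' (E'.mapAlong g' hg'.continuous {l} hSl'
        (Set.singleton_nonempty l) hg'.proSigma).unrKer).comp g').ker).map U'.subtype := by
  rw [← Subgroup.comap_sup_eq _ _ _ hg'.surjective, Subgroup.comap_map_eq, ← MonoidHom.comap_ker,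
    QuotientGroup.ker_mk', Subgroup.map_sup, Subgroup.map_sup, sup_assoc]
  congr 1
  refine sup_eq_right.mpr (Subgroup.map_mono ?_)
  rw [← MonoidHom.comap_bot]
  exact Subgroup.comap_mono bot_le

end Pull

/-! ### 2. The level packages -/

section Packages

variable {P : Type u} [Group P] [TopologicalSpace P] [IsTopologicalGroup P]
variable {P' : Type u} [Group P'] [TopologicalSpace P'] [IsTopologicalGroup P']
variable (G : PSCDatum P) (H : PSCDatum P') (β : (P ⧸ G.unrKer) ≃ₜ* (P' ⧸ H.unrKer))
variable (U : Subgroup P) [U.FiniteIndex] [CompactSpace U] (hU : IsOpen (U : Set P)) (bd : G.BranchData)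
  (hKU : G.unrKer ≤ U)
variable (U' : Subgroup P') [U'.FiniteIndex] [CompactSpace U'] (hU' : IsOpen (U' : Set P'))
  (bd' : H.BranchData) (hUU' : G.unrTransport H β U = U')
variable {Q : Type u} [Group Q] [TopologicalSpace Q] [IsTopologicalGroup Q] [CompactSpace Q]
  [TotallyDisconnectedSpace Q] [T2Space Q]
variable {Q' : Type u} [Group Q'] [TopologicalSpace Q'] [IsTopologicalGroup Q'] [CompactSpace Q']
  [TotallyDisconnectedSpace Q'] [T2Space Q']
variable {l : ℕ} (hSl : ({l} : Set ℕ) ⊆ (G.restrictBD U hU bd).Sigma)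
  (hSl' : ({l} : Set ℕ) ⊆ (H.restrictBD U' hU' bd').Sigma)
  {g : U →* Q} (hg : IsMaxProSigmaQuotient {l} g) {g' : U' →* Q'} (hg' : IsMaxProSigmaQuotient {l} g')
variable (ρ : (Q ⧸ ((G.restrictBD U hU bd).mapAlong g hg.continuous {l} hSl (Set.singleton_nonempty l)
      hg.proSigma).unrKer) ≃ₜ*
    (Q' ⧸ ((H.restrictBD U' hU' bd').mapAlong g' hg'.continuous {l} hSl' (Set.singleton_nonempty l)
      hg'.proSigma).unrKer))
  (hρ : ∀ (x : U) (x' : U'),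
    β (QuotientGroup.mk (x : P)) = (QuotientGroup.mk (x' : P') : P' ⧸ H.unrKer) →
      ρ (QuotientGroup.mk (g x)) = QuotientGroup.mk (g' x'))

include hKU hUU' hρ in
/-- **The level-`U` vertex package from a group-theoretically verticial `ρ`.**  If `ρ` carries the
unramified verticial subgroups of the shadow `D` onto those of `D'` (Def. 1.4 (iv)), then for every
vertex `v` of `G` and every `x ∈ Π_G` there are a vertex `w` of `H` and `y ∈ Π_H` with
`β((U ∩ x Π_v x⁻¹) · L) = (U' ∩ y Π_w y⁻¹) · L'` — the level-`U` vertex `U x Π_v` of `G_U` corresponds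
to the level-`U'` vertex `U' y Π_w` of `H_{U'}` "modulo the pro-prime-to-`l` part".
[cite: MochizukiCombGC2007, Thm 1.6(iii) p.13] -/
theorem unrShadow_vertex_package
    (hρv : ((G.restrictBD U hU bd).mapAlong g hg.continuous {l} hSl (Set.singleton_nonempty l)
      hg.proSigma).IsUnrGroupTheoreticallyVerticial
      ((H.restrictBD U' hU' bd').mapAlong g' hg'.continuous {l} hSl' (Set.singleton_nonempty l) hg'.proSigma) ρ)
    (v : G.graph.V) (x : P) :
    ∃ (w : H.graph.V) (y : P'),
      G.unrTransport H β ((U ⊓ ConjAct.toConjAct x • G.vertGp v) ⊔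
          (((QuotientGroup.mk' ((G.restrictBD U hU bd).mapAlong g hg.continuous {l} hSl
            (Set.singleton_nonempty l) hg.proSigma).unrKer).comp g).ker).map U.subtype) =
        (U' ⊓ ConjAct.toConjAct y • H.vertGp w) ⊔
          (((QuotientGroup.mk' ((H.restrictBD U' hU' bd').mapAlong g' hg'.continuous {l} hSl'
            (Set.singleton_nonempty l) hg'.proSigma).unrKer).comp g').ker).map U'.subtype := by
  have hE : ((G.restrictBD U hU bd).unrKer).map U.subtype = G.unrKer :=
    G.map_subtype_unrKer_restrictBD hU hKU bd
  have hKU' : H.unrKer ≤ U' := hUU' ▸ G.unrKer_le_unrTransport H β U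
  have hE' : ((H.restrictBD U' hU' bd').unrKer).map U'.subtype = H.unrKer :=
    H.map_subtype_unrKer_restrictBD hU' hKU' bd'
  have hL := G.unrTransport_map_subtype_ker H β hU hKU _ hE hU' _ hE' hSl hSl' hg hg' hUU'
  -- the trace `U ∩ x Π_v x⁻¹` as a conjugate of a vertex group of `G_U`
  obtain ⟨δ, hδ⟩ := exists_smul_restrict_vertGp_map_eq (G := G) (U := U) hU v (ConjAct.toConjAct x)
  rw [ConjAct.ofConjAct_toConjAct, ← G.restrictBD_vertGp U hU bd] at hδ
  -- its shadow, made unramified, is an unramified verticial subgroup of `D`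
  have hB : ((G.restrictBD U hU bd).mapAlong g hg.continuous {l} hSl (Set.singleton_nonempty l)
      hg.proSigma).IsUnrVerticial
      (((δ • (G.restrictBD U hU bd).vertGp ⟨v, dcIdx U (G.vertGp v) x⟩).map g) ⊔
        ((G.restrictBD U hU bd).mapAlong g hg.continuous {l} hSl (Set.singleton_nonempty l)
          hg.proSigma).unrKer) :=
    ⟨_, ((G.restrictBD U hU bd).isVerticial_mapAlong_iff g hg.continuous {l} hSl
      (Set.singleton_nonempty l) hg.proSigma hg.surjective _).mpr ⟨_, ⟨_, δ, rfl⟩, rfl⟩, rfl⟩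
  obtain ⟨A'D, hA'D, hEq⟩ := hρv.1 _ hB
  obtain ⟨A', hA', rfl⟩ := ((H.restrictBD U' hU' bd').isVerticial_mapAlong_iff g' hg'.continuous {l} hSl'
    (Set.singleton_nonempty l) hg'.proSigma hg'.surjective _).mp hA'D
  obtain ⟨w, δ', rfl⟩ := hA'
  refine ⟨w.1, ((ConjAct.ofConjAct δ' : U') : P') * H.vrep U' w, ?_⟩
  rw [unrTransport_sup_unrKer,
    G.unrShadow_transport_map H β _ _ hUU' hSl hSl' hg hg' ρ hρ] at hEq
  have hEq2 := congrArg (fun Z : Subgroup Q' => (Z.comap g').map U'.subtype) hEq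
  rw [map_subtype_comap_map_sup_unrKer _ hSl' hg', map_subtype_comap_map_sup_unrKer _ hSl' hg',
    G.map_subtype_comap_unrTransport H β hUU', hδ, H.restrictBD_vertGp U' hU' bd',
    map_subtype_smul_restrict_vertGp] at hEq2
  rw [G.unrTransport_sup H β, hL]
  exact hEq2

include hKU hUU' hρ in
/-- **The converse package**: every level-`U'` vertex `U' y Π_w` of `H_{U'}` corresponds to some
level-`U` vertex `U x Π_v` of `G_U` under the same relation (from "every [unramified] verticial subgroup
of `Π^unr` of `D'` arises" in Def. 1.4 (iv) for `ρ`). [cite: MochizukiCombGC2007, Thm 1.6(iii) p.13] -/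
theorem unrShadow_vertex_package'
    (hρv : ((G.restrictBD U hU bd).mapAlong g hg.continuous {l} hSl (Set.singleton_nonempty l)
      hg.proSigma).IsUnrGroupTheoreticallyVerticial
      ((H.restrictBD U' hU' bd').mapAlong g' hg'.continuous {l} hSl' (Set.singleton_nonempty l) hg'.proSigma) ρ)
    (w : H.graph.V) (y : P') :
    ∃ (v : G.graph.V) (x : P),
      G.unrTransport H β ((U ⊓ ConjAct.toConjAct x • G.vertGp v) ⊔
          (((QuotientGroup.mk' ((G.restrictBD U hU bd).mapAlong g hg.continuous {l} hSl
            (Set.singleton_nonempty l) hg.proSigma).unrKer).comp g).ker).map U.subtype) =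
        (U' ⊓ ConjAct.toConjAct y • H.vertGp w) ⊔
          (((QuotientGroup.mk' ((H.restrictBD U' hU' bd').mapAlong g' hg'.continuous {l} hSl'
            (Set.singleton_nonempty l) hg'.proSigma).unrKer).comp g').ker).map U'.subtype := by
  have hE : ((G.restrictBD U hU bd).unrKer).map U.subtype = G.unrKer :=
    G.map_subtype_unrKer_restrictBD hU hKU bd
  have hKU' : H.unrKer ≤ U' := hUU' ▸ G.unrKer_le_unrTransport H β U
  have hE' : ((H.restrictBD U' hU' bd').unrKer).map U'.subtype = H.unrKer :=
    H.map_subtype_unrKer_restrictBD hU' hKU' bd'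
  have hL := G.unrTransport_map_subtype_ker H β hU hKU _ hE hU' _ hE' hSl hSl' hg hg' hUU'
  obtain ⟨δ', hδ'⟩ := exists_smul_restrict_vertGp_map_eq (G := H) (U := U') hU' w (ConjAct.toConjAct y)
  rw [ConjAct.ofConjAct_toConjAct, ← H.restrictBD_vertGp U' hU' bd'] at hδ'
  have hB' : ((H.restrictBD U' hU' bd').mapAlong g' hg'.continuous {l} hSl' (Set.singleton_nonempty l)
      hg'.proSigma).IsUnrVerticial
      (((δ' • (H.restrictBD U' hU' bd').vertGp ⟨w, dcIdx U' (H.vertGp w) y⟩).map g') ⊔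
        ((H.restrictBD U' hU' bd').mapAlong g' hg'.continuous {l} hSl' (Set.singleton_nonempty l)
          hg'.proSigma).unrKer) :=
    ⟨_, ((H.restrictBD U' hU' bd').isVerticial_mapAlong_iff g' hg'.continuous {l} hSl'
      (Set.singleton_nonempty l) hg'.proSigma hg'.surjective _).mpr ⟨_, ⟨_, δ', rfl⟩, rfl⟩, rfl⟩
  obtain ⟨B, hBv, hEq⟩ := hρv.2 _ hB'
  obtain ⟨AD, hAD, rfl⟩ := hBv
  obtain ⟨A, hA, rfl⟩ := ((G.restrictBD U hU bd).isVerticial_mapAlong_iff g hg.continuous {l} hSl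
    (Set.singleton_nonempty l) hg.proSigma hg.surjective _).mp hAD
  obtain ⟨v, δ, rfl⟩ := hA
  refine ⟨v.1, ((ConjAct.ofConjAct δ : U) : P) * G.vrep U v, ?_⟩
  rw [unrTransport_sup_unrKer,
    G.unrShadow_transport_map H β _ _ hUU' hSl hSl' hg hg' ρ hρ] at hEq
  have hEq2 := congrArg (fun Z : Subgroup Q' => (Z.comap g').map U'.subtype) hEq
  rw [map_subtype_comap_map_sup_unrKer _ hSl' hg', map_subtype_comap_map_sup_unrKer _ hSl' hg',
    G.map_subtype_comap_unrTransport H β hUU', hδ', G.restrictBD_vertGp U hU bd,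
    map_subtype_smul_restrict_vertGp] at hEq2
  rw [G.unrTransport_sup H β, hL]
  exact hEq2

end Packages

/-! ### 3. Separation modulo `L` from Prop. 1.2 (i) for the sturdy shadow -/

section Separation

variable {A : Type*} [Group A] [TopologicalSpace A] {B : Type*} [Group B] [TopologicalSpace B]

/-- "`S₁ ∩ S₂` open in `S₁`" pulls back along a continuous homomorphism.
[cite: MochizukiCombGC2007, Prop 1.2(i) p.8] -/
theorem isOpen_inf_subgroupOf_comap (f : A →* B) (hf : Continuous f) (S₁ S₂ : Subgroup B)
    (h : IsOpen (((S₁ ⊓ S₂).subgroupOf S₁ : Subgroup S₁) : Set S₁)) :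
    IsOpen ((((S₁.comap f) ⊓ (S₂.comap f)).subgroupOf (S₁.comap f) : Subgroup (S₁.comap f)) :
      Set (S₁.comap f)) := by
  let π : S₁.comap f → S₁ := fun a => ⟨f a, a.2⟩
  have hπ : Continuous π := (hf.comp continuous_subtype_val).subtype_mk _
  have hpre : ((((S₁.comap f) ⊓ (S₂.comap f)).subgroupOf (S₁.comap f) : Subgroup (S₁.comap f)) :
      Set (S₁.comap f)) = π ⁻¹' (((S₁ ⊓ S₂).subgroupOf S₁ : Subgroup S₁) : Set S₁) := by
    ext a
    simp only [SetLike.mem_coe, Subgroup.mem_subgroupOf, Subgroup.mem_inf, Subgroup.mem_comap,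
      Set.mem_preimage, π]
  rw [hpre]
  exact h.preimage hπ

omit [TopologicalSpace B] in
/-- Conjugating the image in `B/N` by `[q]` is the image of conjugating by `q`.
[cite: MochizukiCombGC2007, Def 1.1(ii) p.6] -/
theorem conjAct_mk_smul_map_mk (N : Subgroup B) [N.Normal] (q : B) (Y : Subgroup B) :
    ConjAct.toConjAct (QuotientGroup.mk' N q) • Y.map (QuotientGroup.mk' N) =
      (ConjAct.toConjAct q • Y).map (QuotientGroup.mk' N) := by
  rw [map_conj_smul, ConjAct.ofConjAct_toConjAct]

omit [TopologicalSpace B] in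
/-- The preimage in `B` of the image of `q Y q⁻¹` in `B/N` is `q Y q⁻¹ · N`.
[cite: MochizukiCombGC2007, Def 1.1(ii) p.6] -/
theorem comap_mk_map_mk_conjAct_smul (N : Subgroup B) [N.Normal] (q : B) (Y : Subgroup B) :
    ((ConjAct.toConjAct q • Y).map (QuotientGroup.mk' N)).comap (QuotientGroup.mk' N) =
      ConjAct.toConjAct q • Y ⊔ N := by
  rw [Subgroup.comap_map_eq, QuotientGroup.ker_mk']

variable {P : Type u} [Group P] [TopologicalSpace P] [IsTopologicalGroup P]
variable (G : PSCDatum P) (U : Subgroup P) [U.Normal] [U.FiniteIndex] [CompactSpace U]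
  (hU : IsOpen (U : Set P)) (bd : G.BranchData) (hKU : G.unrKer ≤ U)
variable {Q : Type u} [Group Q] [TopologicalSpace Q] [IsTopologicalGroup Q] [CompactSpace Q]
  [TotallyDisconnectedSpace Q] [T2Space Q]
variable {l : ℕ} (hSl : ({l} : Set ℕ) ⊆ (G.restrictBD U hU bd).Sigma)
  {g : U →* Q} (hg : IsMaxProSigmaQuotient {l} g)

omit [U.Normal] [CompactSpace Q] [TotallyDisconnectedSpace Q] in
/-- Prop. 1.2 (i) (unramified verticial case) for the sturdy shadow `D` yields the separation
hypothesis of abc-iut-w5-d174's `sep_mod_ker_of_shadow` for the family of images in `Q/Ker(Q ↠ Π^unr_D)`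
of the vertex groups of `D`. [cite: MochizukiCombGC2007, Prop 1.2(i) p.8] -/
theorem unrShadow_hsep
    (hDs : ((G.restrictBD U hU bd).mapAlong g hg.continuous {l} hSl (Set.singleton_nonempty l)
      hg.proSigma).IsSturdy)
    (h12 : ((G.restrictBD U hU bd).mapAlong g hg.continuous {l} hSl (Set.singleton_nonempty l)
      hg.proSigma).UnrVerticialOpenInterDeterminesVertex)
    (w₁ w₂ : (G.restrictGraphBD U bd).V)
    (γ₁ γ₂ : ConjAct (Q ⧸ ((G.restrictBD U hU bd).mapAlong g hg.continuous {l} hSl (Set.singleton_nonempty l)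
      hg.proSigma).unrKer))
    (hopen : IsOpen (((γ₁ • (((G.restrictBD U hU bd).mapAlong g hg.continuous {l} hSl
        (Set.singleton_nonempty l) hg.proSigma).vertGp w₁).map (QuotientGroup.mk' _) ⊓
      γ₂ • (((G.restrictBD U hU bd).mapAlong g hg.continuous {l} hSl (Set.singleton_nonempty l)
        hg.proSigma).vertGp w₂).map (QuotientGroup.mk' _)).subgroupOf
        (γ₁ • (((G.restrictBD U hU bd).mapAlong g hg.continuous {l} hSl (Set.singleton_nonempty l)
          hg.proSigma).vertGp w₁).map (QuotientGroup.mk' _)) :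
      Subgroup (γ₁ • (((G.restrictBD U hU bd).mapAlong g hg.continuous {l} hSl (Set.singleton_nonempty l)
        hg.proSigma).vertGp w₁).map (QuotientGroup.mk' ((G.restrictBD U hU bd).mapAlong g hg.continuous
          {l} hSl (Set.singleton_nonempty l) hg.proSigma).unrKer) : Subgroup _)) :
        Set (γ₁ • (((G.restrictBD U hU bd).mapAlong g hg.continuous {l} hSl (Set.singleton_nonempty l)
          hg.proSigma).vertGp w₁).map (QuotientGroup.mk' ((G.restrictBD U hU bd).mapAlong g
            hg.continuous {l} hSl (Set.singleton_nonempty l) hg.proSigma).unrKer) : Subgroup _))) :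
    w₁ = w₂ := by
  obtain ⟨q₁, hq₁⟩ := QuotientGroup.mk_surjective (ConjAct.ofConjAct γ₁)
  obtain ⟨q₂, hq₂⟩ := QuotientGroup.mk_surjective (ConjAct.ofConjAct γ₂)
  have hγ₁ : γ₁ = ConjAct.toConjAct (QuotientGroup.mk' _ q₁) := by
    rw [QuotientGroup.mk'_apply, hq₁, ConjAct.toConjAct_ofConjAct]
  have hγ₂ : γ₂ = ConjAct.toConjAct (QuotientGroup.mk' _ q₂) := by
    rw [QuotientGroup.mk'_apply, hq₂, ConjAct.toConjAct_ofConjAct]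
  subst hγ₁
  subst hγ₂
  rw [isOpen_inf_subgroupOf_congr (conjAct_mk_smul_map_mk _ q₁ _) (conjAct_mk_smul_map_mk _ q₂ _)] at hopen
  have hop := isOpen_inf_subgroupOf_comap (QuotientGroup.mk' _) QuotientGroup.continuous_mk _ _ hopen
  rw [isOpen_inf_subgroupOf_congr (comap_mk_map_mk_conjAct_smul _ q₁ _)
    (comap_mk_map_mk_conjAct_smul _ q₂ _)] at hop
  exact h12 hDs w₁ w₂ (ConjAct.toConjAct q₁) (ConjAct.toConjAct q₂) hop

include hKU in
omit [CompactSpace Q] [TotallyDisconnectedSpace Q] in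
/-- `ker(U ↠ Q ↠ Q/Ker(Q ↠ Π^unr_D))↑` is normal in `Π_G` (it is the intersection of the level family,
`PSCUnrShadowKernel`). [cite: MochizukiCombGC2007, Thm 1.6(iii) p.13] -/
theorem map_subtype_unrShadowKer_normal [CompactSpace Q] [TotallyDisconnectedSpace Q] :
    ((((QuotientGroup.mk' ((G.restrictBD U hU bd).mapAlong g hg.continuous {l} hSl
        (Set.singleton_nonempty l) hg.proSigma).unrKer).comp g).ker).map U.subtype).Normal := by
  rw [G.map_subtype_ker_eq_iInf U hU hKU _ (G.map_subtype_unrKer_restrictBD hU hKU bd) hSl hg]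
  exact G.iInf_level_family_normal U l

include hKU in
/-- **Separation modulo `L`.**  For the sturdy shadow `D` of `G_U` satisfying Prop. 1.2 (i) (unramified
verticial case): if `(U ∩ x₁ Π_{v₁} x₁⁻¹) · L` is `U`-conjugate to `(U ∩ x₂ Π_{v₂} x₂⁻¹) · L`, where
`L = ker(U ↠ Q ↠ Q/Ker(Q ↠ Π^unr_D))↑`, then the level-`U` vertices `U x₁ Π_{v₁}`, `U x₂ Π_{v₂}` of `G_U`
coincide — abc-iut-w5-d174's generic `sep_mod_ker_of_shadow` for the presentation `U ↠ Q ↠ Q/Ker`.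
[cite: MochizukiCombGC2007, Prop 1.2(i) p.8] -/
theorem unrShadow_sep
    (hDs : ((G.restrictBD U hU bd).mapAlong g hg.continuous {l} hSl (Set.singleton_nonempty l)
      hg.proSigma).IsSturdy)
    (h12 : ((G.restrictBD U hU bd).mapAlong g hg.continuous {l} hSl (Set.singleton_nonempty l)
      hg.proSigma).UnrVerticialOpenInterDeterminesVertex)
    (v₁ v₂ : G.graph.V) (x₁ x₂ : P)
    (h : ∃ u ∈ U, (U ⊓ ConjAct.toConjAct x₁ • G.vertGp v₁) ⊔
        (((QuotientGroup.mk' ((G.restrictBD U hU bd).mapAlong g hg.continuous {l} hSl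
          (Set.singleton_nonempty l) hg.proSigma).unrKer).comp g).ker).map U.subtype =
      ConjAct.toConjAct u • ((U ⊓ ConjAct.toConjAct x₂ • G.vertGp v₂) ⊔
        (((QuotientGroup.mk' ((G.restrictBD U hU bd).mapAlong g hg.continuous {l} hSl
          (Set.singleton_nonempty l) hg.proSigma).unrKer).comp g).ker).map U.subtype)) :
    (⟨v₁, DoubleCoset.mk U (G.vertGp v₁) x₁⟩ :
        Σ v, DoubleCoset.Quotient (U : Set P) (G.vertGp v : Set P)) =
      ⟨v₂, DoubleCoset.mk U (G.vertGp v₂) x₂⟩ := by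
  refine sep_mod_ker_of_shadow (T := G.vertGp)
    (g' := (QuotientGroup.mk' ((G.restrictBD U hU bd).mapAlong g hg.continuous {l} hSl
      (Set.singleton_nonempty l) hg.proSigma).unrKer).comp g)
    inferInstance ((QuotientGroup.mk'_surjective _).comp hg.surjective)
    (G.map_subtype_unrShadowKer_normal U hU bd hKU hSl hg)
    (fun w => (((G.restrictBD U hU bd).mapAlong g hg.continuous {l} hSl (Set.singleton_nonempty l)
      hg.proSigma).vertGp w).map (QuotientGroup.mk' _))
    (fun w => by rw [mapAlong_vertGp, Subgroup.map_map]; rfl)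
    (fun w₁ w₂ γ₁ γ₂ hopen => G.unrShadow_hsep U hU bd hSl hg hDs h12 w₁ w₂ γ₁ γ₂ hopen) v₁ x₁ v₂ x₂ h

end Separation

end PSCDatum

end Literature.AnabelianGeometry.SemiGraphs
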